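import Mathlib.FieldTheory.Finite.GaloisField
import Mathlib.FieldTheory.Normal.Closure
import Literature.NumberTheory.GaloisRepresentations.IntegralGaloisActionProofs
import HarnessLib

/-!
# The decomposition group is generated by Frobenius and inertia, modulo open subgroups
(trunk GalRep; input of the induction invariance of Artin L-functions, Neukirch VII (10.4) (iv))

Topic `NumberTheory/GaloisRepresentations`.  Let `K` be a number field, `v` a finite place,
`𝔓 ∣ v` a prime of `\bar ℤ_K = absIntegers (𝓞 K) K`, `G_𝔓 ≥ I_𝔓` its decomposition and
inertia groups in `Γ_K` and `φ` an arithmetic Frobenius at `𝔓`.  Classically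
`G_𝔓/I_𝔓 ≅ Gal(\bar 𝔽_q/𝔽_q) ≅ Ẑ` is topologically generated by `φ`, so that in every finite
quotient `G(L|K)` of `Γ_K` the decomposition group is `⟨φ̄⟩ · Ī` (Neukirch, *Algebraic Number
Theory*, I §9, Prop. (9.4): "`G_𝔓/I_𝔓 ≅ G(κ(𝔓)|κ(𝔭))`", (9.5) and VII §10, proof of (10.4) (iv):
"Then `G` is generated by `φ`" once `I = 1`).  This file proves the form of this statement
needed for Artin L-functions, without developing `Ẑ`:

* `Literature.NumberTheory.GaloisRepresentations.exists_eq_frobenius_pow_mul_of_mem_decompositionSubgroup` (**proved**): for every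
  open subgroup `U ≤ Γ_K` and every `d ∈ G_𝔓` there are `n ∈ ℕ`, `i ∈ I_𝔓`, `u ∈ U` with
  `d = φⁿ · i · u`.

Proof.  (1) Compactness: `G_𝔓` is closed (`absIntegers.isClosed_decompositionSubgroup_holds`)
in the compact `Γ_K`; the closed sets `K_S = {d ∈ G_𝔓 | d x ≡ x (mod 𝔓) ∀ x ∈ S}`, `S ⊆ \bar ℤ_K`
finite, are directed with intersection `I_𝔓 ⊆ I_𝔓 · U` (open), so some `K_S ⊆ I_𝔓 · U`
(`IsCompact.elim_directed_family_closed`; the action on the discrete `\bar ℤ_K` is continuous,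
`absIntegers.continuousSMul`).  (2) Finite fields: `d ∈ G_𝔓` acts on `κ(𝔓) = \bar ℤ_K/𝔓` over
`κ(v)` (Mathlib `Ideal.Quotient.stabilizerHom`); the residues of `S` generate a finite, hence
Galois, subextension `k'/κ(v)` (Mathlib's `IsGalois` instance for finite fields), stable under
`d̄` (`IntermediateField.normal_iff_forall_map_le'`), on which `d̄` is a power `Frobⁿ` of the
`q`-power map (Mathlib `FiniteField.bijective_frobeniusAlgEquivOfAlgebraic_pow`); as
`φⁿ x ≡ x^{qⁿ} (mod 𝔓)`, `φ⁻ⁿ d ∈ K_S ⊆ I_𝔓 · U`.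

## Mathlib / tree search

Mathlib has the finite-level statement (`Ideal.Quotient.stabilizerHom_surjective`, `IsCyclic`
Galois groups of finite fields) and the profinite surjectivity
`Ideal.Quotient.stabilizerHom_surjective_of_profinite`, but not the topological generation of
`G_𝔓/I_𝔓` by Frobenius (`lean search 'procyclic|topologicalClosure.*zpowers.*Frob'`: nothing);
tree: `lean search 'decompositionSubgroup.*zpowers|Frobenius.*generat'`: nothing.  No
definition is introduced.

## References

* J. Neukirch, *Algebraic Number Theory* (1999), I §9 Prop. (9.4)–(9.5); VII §10, proof of
  (10.4) (iv), p. 524 (`NeukirchANT1999`).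
* J.-P. Serre, *Local Fields* (1979), Ch. I §7 Prop. 20–21 (decomposition and inertia groups,
  the residue extension) and §8 (the Frobenius substitution "generates the decomposition
  group") (`SerreLocalFields1979`).
-/

noncomputable section

open scoped NumberField Pointwise
open Field IsDedekindDomain NumberField

namespace Literature.NumberTheory.GaloisRepresentations

/-! ### Automorphisms of algebraic extensions of finite fields on finite sets -/

section FiniteField

variable {k₀ k : Type*} [Field k₀] [Fintype k₀] [Field k] [Algebra k₀ k]

/-- **An automorphism of an algebraic extension of a finite field is a power of Frobenius on
any finite set**: for `σ ∈ Aut(k/k₀)`, `k₀` finite with `q` elements and `k/k₀` algebraic, and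
a finite `S ⊆ k`, there is `n` with `σ y = y^{qⁿ}` for all `y ∈ S` (the subfield `k₀(S)` is
finite, hence Galois over `k₀`, stable under `σ`, and its Galois group consists of the powers
of the `q`-Frobenius).  Ref: Serre, *Local Fields*, Ch. I §7–§8; Neukirch I §9 (9.4). [folklore] -/
theorem exists_forall_algEquiv_apply_eq_pow [Algebra.IsAlgebraic k₀ k] (σ : k ≃ₐ[k₀] k)
    (S : Finset k) : ∃ n : ℕ, ∀ y ∈ S, σ y = y ^ (Fintype.card k₀ ^ n) := by
  classical
  set k' : IntermediateField k₀ k := IntermediateField.adjoin k₀ (S : Set k) with hk'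
  haveI : FiniteDimensional k₀ k' :=
    IntermediateField.finiteDimensional_adjoin fun x _ => Algebra.IsIntegral.isIntegral x
  haveI : Finite k' := Module.finite_of_finite k₀
  haveI : Normal k₀ k' := IsGalois.to_normal
  -- `σ` preserves `k'`
  set σ' : k' ≃ₐ[k₀] k' := σ.restrictNormal k' with hσ'
  have hσ'c : ∀ y : k', (σ' y : k) = σ y := fun y => AlgEquiv.restrictNormal_commutes σ k' y
  obtain ⟨⟨n, _⟩, hn⟩ := (FiniteField.bijective_frobeniusAlgEquivOfAlgebraic_pow k₀ k').2 σ'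
  refine ⟨n, fun y hy => ?_⟩
  have hyk' : y ∈ k' := IntermediateField.subset_adjoin k₀ (S : Set k) hy
  have h1 := hσ'c ⟨y, hyk'⟩
  rw [← hn] at h1
  change ((FiniteField.frobeniusAlgEquivOfAlgebraic k₀ k' ^ n) ⟨y, hyk'⟩ : k) = σ y at h1
  rw [← h1, AlgEquiv.coe_pow, FiniteField.coe_frobeniusAlgEquivOfAlgebraic_iterate]
  rfl

end FiniteField

/-! ### Frobenius congruences on finite sets -/

section Residue

variable {K : Type*} [Field K] [NumberField K]

/-- Powers of an arithmetic Frobenius: `φⁿ • x ≡ x^{(N v)ⁿ} (mod 𝔓)`.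
Ref: Neukirch, *Algebraic Number Theory*, I §9, (9.4)–(9.6). [folklore] -/
theorem pow_smul_sub_pow_mem_of_isArithFrobAt {v : HeightOneSpectrum (𝓞 K)}
    {𝔓 : Ideal (absIntegers (𝓞 K) K)} (h𝔓 : 𝔓 ∈ v.primesAbove) {φ : absoluteGaloisGroup K}
    (hφ : IsArithFrobAt (𝓞 K) φ 𝔓) (n : ℕ) (x : absIntegers (𝓞 K) K) :
    φ ^ n • x - x ^ (v.residueCard ^ n) ∈ 𝔓 := by
  have hφ' := (HeightOneSpectrum.isArithFrobAt_iff_of_mem_primesAbove h𝔓 φ).mp hφ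
  induction n generalizing x with
  | zero => simp
  | succ k ih =>
    rw [pow_succ', mul_smul, pow_succ, pow_mul]
    have h1 := hφ' (φ ^ k • x)
    have h2 : (φ ^ k • x) ^ v.residueCard - (x ^ v.residueCard ^ k) ^ v.residueCard ∈ 𝔓 := by
      rw [← Ideal.Quotient.eq_zero_iff_mem, map_sub, map_pow, map_pow, sub_eq_zero]
      congr 1
      rw [← sub_eq_zero, ← map_sub, Ideal.Quotient.eq_zero_iff_mem]
      exact ih x
    have := add_mem h1 h2
    rwa [sub_add_sub_cancel] at this

attribute [local instance] Ideal.Quotient.field in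
/-- **An element of the decomposition group acts on finitely many residues as a power of
Frobenius**: for `d ∈ G_𝔓` and a finite `S ⊆ \bar ℤ_K` there is `n` with
`d • x ≡ x^{(N v)ⁿ} (mod 𝔓)` for all `x ∈ S` (apply `exists_forall_algEquiv_apply_eq_pow` to
the automorphism of `κ(𝔓)/κ(v)` induced by `d`, Mathlib `Ideal.Quotient.stabilizerHom`).
Ref: Neukirch, *Algebraic Number Theory*, I §9, Prop. (9.4). [folklore] -/
theorem exists_forall_smul_sub_pow_mem {v : HeightOneSpectrum (𝓞 K)}
    {𝔓 : Ideal (absIntegers (𝓞 K) K)} (h𝔓 : 𝔓 ∈ v.primesAbove) {d : absoluteGaloisGroup K}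
    (hd : d ∈ 𝔓.decompositionSubgroup (absoluteGaloisGroup K))
    (S : Finset (absIntegers (𝓞 K) K)) :
    ∃ n : ℕ, ∀ x ∈ S, d • x - x ^ (v.residueCard ^ n) ∈ 𝔓 := by
  classical
  haveI : 𝔓.IsPrime := h𝔓.1
  haveI : 𝔓.LiesOver v.asIdeal := h𝔓.2
  haveI : 𝔓.IsMaximal := HeightOneSpectrum.isMaximal_of_mem_primesAbove h𝔓
  haveI : v.asIdeal.IsMaximal := v.isPrime.isMaximal v.ne_bot
  set p : Ideal (𝓞 K) := v.asIdeal with hp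
  haveI : Finite (𝓞 K ⧸ p) := by
    have := HeightOneSpectrum.finite_quotient_under_of_mem_primesAbove h𝔓
    rwa [← h𝔓.2.over] at this
  letI : Fintype (𝓞 K ⧸ p) := Fintype.ofFinite _
  haveI : Algebra.IsAlgebraic (𝓞 K ⧸ p) (absIntegers (𝓞 K) K ⧸ 𝔓) := Algebra.IsIntegral.isAlgebraic
  have hq : Fintype.card (𝓞 K ⧸ p) = v.residueCard := by
    rw [Fintype.card_eq_nat_card, HeightOneSpectrum.residueCard_eq_card_quotient]
  let σ : (absIntegers (𝓞 K) K ⧸ 𝔓) ≃ₐ[𝓞 K ⧸ p] (absIntegers (𝓞 K) K ⧸ 𝔓) :=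
    Ideal.Quotient.stabilizerHom 𝔓 p (absoluteGaloisGroup K) ⟨d, hd⟩
  have hσ : ∀ x, σ (Ideal.Quotient.mk 𝔓 x) = Ideal.Quotient.mk 𝔓 (d • x) := fun x => rfl
  obtain ⟨n, hn⟩ := exists_forall_algEquiv_apply_eq_pow σ (S.image (Ideal.Quotient.mk 𝔓))
  refine ⟨n, fun x hx => ?_⟩
  have h1 := hn _ (Finset.mem_image_of_mem _ hx)
  rw [hσ, hq, ← map_pow] at h1
  rw [← Ideal.Quotient.eq_zero_iff_mem, map_sub, sub_eq_zero]
  exact h1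

end Residue

/-! ### The main statement -/

section Generation

variable {K : Type*} [Field K] [NumberField K]

omit [NumberField K] in
/-- The set `{g | g • x - x ∈ 𝔓}` is closed in `Γ_K` (the action on the discrete `\bar ℤ_K` is
continuous, `absIntegers.continuousSMul`). [folklore] -/
theorem isClosed_setOf_smul_sub_mem (𝔓 : Ideal (absIntegers (𝓞 K) K)) (x : absIntegers (𝓞 K) K) :
    IsClosed {g : absoluteGaloisGroup K | g • x - x ∈ 𝔓} := by
  letI : TopologicalSpace (absIntegers (𝓞 K) K) := ⊥
  haveI : DiscreteTopology (absIntegers (𝓞 K) K) := ⟨rfl⟩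
  haveI := absIntegers.continuousSMul (R := 𝓞 K) (K := K)
  have hc : Continuous fun g : absoluteGaloisGroup K => g • x := continuous_id.smul continuous_const
  exact (isClosed_discrete {y : absIntegers (𝓞 K) K | y - x ∈ 𝔓}).preimage hc

/-- **`G_𝔓 = ⟨φ⟩ · I_𝔓 · U` for every open subgroup `U`** (Neukirch, *Algebraic Number Theory*,
I §9 Prop. (9.4): `G_𝔓/I_𝔓 ≅ G(κ(𝔓)|κ(v))`, generated by Frobenius; VII §10, proof of (10.4)
(iv): "`G` is generated by `φ`").  Let `𝔓 ∣ v` be a prime of `\bar ℤ_K`, `φ` an arithmetic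
Frobenius at `𝔓` and `U ≤ Γ_K` an open subgroup.  Every `d` in the decomposition group `G_𝔓`
can be written `d = φⁿ · i · u` with `n ∈ ℕ`, `i ∈ I_𝔓` and `u ∈ U`.  Equivalently: in every
finite (discrete) quotient of `Γ_K`, the image of `G_𝔓` is generated by the images of `φ` and
`I_𝔓`.  Proof by compactness of `G_𝔓` and finite-field Galois theory (module docstring).
[cite: NeukirchANT1999, I §9 Prop. (9.4) and VII §10 proof of (10.4) (iv)]
[cite: SerreLocalFields1979, Ch. I §7–§8] -/
theorem exists_eq_frobenius_pow_mul_of_mem_decompositionSubgroup {v : HeightOneSpectrum (𝓞 K)}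
    {𝔓 : Ideal (absIntegers (𝓞 K) K)} (h𝔓 : 𝔓 ∈ v.primesAbove) {φ : absoluteGaloisGroup K}
    (hφ : IsArithFrobAt (𝓞 K) φ 𝔓) {U : Subgroup (absoluteGaloisGroup K)}
    (hU : IsOpen (U : Set (absoluteGaloisGroup K))) {d : absoluteGaloisGroup K}
    (hd : d ∈ 𝔓.decompositionSubgroup (absoluteGaloisGroup K)) :
    ∃ (n : ℕ) (i u : absoluteGaloisGroup K), i ∈ 𝔓.inertia (absoluteGaloisGroup K) ∧ u ∈ U ∧
      d = φ ^ n * i * u := by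
  classical
  haveI : 𝔓.IsPrime := h𝔓.1
  set D : Subgroup (absoluteGaloisGroup K) := 𝔓.decompositionSubgroup (absoluteGaloisGroup K) with hD
  set I : Subgroup (absoluteGaloisGroup K) := 𝔓.inertia (absoluteGaloisGroup K) with hI
  -- the open set `W = I · U`
  set W : Set (absoluteGaloisGroup K) := ⋃ i ∈ I, i • (U : Set (absoluteGaloisGroup K)) with hW
  have hWopen : IsOpen W := isOpen_biUnion fun i _ => hU.smul i
  have hWmem : ∀ g, g ∈ W ↔ ∃ i ∈ I, ∃ u ∈ U, g = i * u := by
    intro g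
    simp only [hW, Set.mem_iUnion, Set.mem_smul_set, smul_eq_mul, exists_prop]
    constructor
    · rintro ⟨i, hi, u, hu, rfl⟩; exact ⟨i, hi, u, hu, rfl⟩
    · rintro ⟨i, hi, u, hu, rfl⟩; exact ⟨i, hi, u, hu, rfl⟩
  have hIW : ∀ i ∈ I, i ∈ W := fun i hi => (hWmem i).mpr ⟨i, hi, 1, U.one_mem, (mul_one i).symm⟩
  -- the closed sets `K_S`
  set KS : Finset (absIntegers (𝓞 K) K) → Set (absoluteGaloisGroup K) := fun S =>
    (D : Set (absoluteGaloisGroup K)) ∩ ⋂ x ∈ S, {g | g • x - x ∈ 𝔓} with hKS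
  have hKSclosed : ∀ S, IsClosed (KS S) := fun S =>
    (absIntegers.isClosed_decompositionSubgroup_holds (R := 𝓞 K) 𝔓).inter
      (isClosed_biInter fun x _ => isClosed_setOf_smul_sub_mem 𝔓 x)
  have hmemKS : ∀ S g, g ∈ KS S ↔ g ∈ D ∧ ∀ x ∈ S, g • x - x ∈ 𝔓 := by
    intro S g
    simp only [hKS, Set.mem_inter_iff, SetLike.mem_coe, Set.mem_iInter, Set.mem_setOf_eq]
  -- compactness: some `K_S ⊆ W`
  have hDclosed : IsClosed (D : Set (absoluteGaloisGroup K)) :=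
    absIntegers.isClosed_decompositionSubgroup_holds (R := 𝓞 K) 𝔓
  have hcpt : IsCompact ((D : Set (absoluteGaloisGroup K)) ∩ Wᶜ) :=
    (hDclosed.inter hWopen.isClosed_compl).isCompact
  have hempty : ((D : Set (absoluteGaloisGroup K)) ∩ Wᶜ) ∩ ⋂ S, KS S = ∅ := by
    rw [Set.eq_empty_iff_forall_notMem]
    rintro g ⟨⟨-, hgW⟩, hall⟩
    rw [Set.mem_iInter] at hall
    exact hgW (hIW g fun x => ((hmemKS {x} g).mp (hall {x})).2 x (Finset.mem_singleton_self x))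
  have hdir : Directed (· ⊇ ·) KS := by
    intro S₁ S₂
    refine ⟨S₁ ∪ S₂, fun g hg => ?_, fun g hg => ?_⟩
    · rw [hmemKS] at hg ⊢
      exact ⟨hg.1, fun x hx => hg.2 x (Finset.mem_union_left _ hx)⟩
    · rw [hmemKS] at hg ⊢
      exact ⟨hg.1, fun x hx => hg.2 x (Finset.mem_union_right _ hx)⟩
  obtain ⟨S, hS⟩ := hcpt.elim_directed_family_closed KS hKSclosed hempty hdir
  have hKSW : KS S ⊆ W := by
    intro g hg
    by_contra hgW
    have : g ∈ ((D : Set (absoluteGaloisGroup K)) ∩ Wᶜ) ∩ KS S := ⟨⟨((hmemKS S g).mp hg).1, hgW⟩, hg⟩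
    rw [hS] at this
    exact this
  -- Frobenius powers on the residues of `S`
  obtain ⟨n, hn⟩ := exists_forall_smul_sub_pow_mem h𝔓 hd S
  have hφD : φ ∈ D := hφ.mem_stabilizer
  set g := (φ ^ n)⁻¹ * d with hg
  have hgKS : g ∈ KS S := by
    refine (hmemKS S g).mpr ⟨D.mul_mem (D.inv_mem (D.pow_mem hφD n)) hd, fun x hx => ?_⟩
    -- `g • x - x = φ⁻ⁿ • (d • x - φⁿ • x)` with `d • x ≡ x^{qⁿ} ≡ φⁿ • x`
    have h1 : d • x - φ ^ n • x ∈ 𝔓 := by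
      have := sub_mem (hn x hx) (pow_smul_sub_pow_mem_of_isArithFrobAt h𝔓 hφ n x)
      rwa [sub_sub_sub_cancel_right] at this
    have h2 : g • x - x = (φ ^ n)⁻¹ • (d • x - φ ^ n • x) := by
      rw [smul_sub, hg, mul_smul, inv_smul_smul]
    have hstab : (φ ^ n)⁻¹ • 𝔓 = 𝔓 :=
      Ideal.mem_decompositionSubgroup_iff.mp (D.inv_mem (D.pow_mem hφD n))
    rw [h2]
    have h3 := Ideal.smul_mem_pointwise_smul ((φ ^ n)⁻¹) _ 𝔓 h1
    rwa [hstab] at h3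
  obtain ⟨i, hi, u, hu, hgu⟩ := (hWmem g).mp (hKSW hgKS)
  refine ⟨n, i, u, hi, hu, ?_⟩
  rw [mul_assoc, ← hgu, hg, mul_inv_cancel_left]

end Generation

end Literature.NumberTheory.GaloisRepresentations

end
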